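import Literature.Topology.FourManifolds.LefschetzBasePages
import Literature.Topology.FourManifolds.TorusKnotMilnorFibreHomology
import HarnessLib

/-!
# The standard Lefschetz base of genus `g`, VII: the chain loops along ARCS of branch points

Topic `Literature/Topology/FourManifolds`; namespace `Literature.Topology.FourManifolds.LefschetzBase`.
Supplement to §7 of `LefschetzBasePages.lean` (the `A_{2g}` chain `chainLoop g i`: out along the
CHORD `[ζ_i, ζ_{i+1}]` on the upper sheet of the central page `y² = x^{2g+1} + 1`, back on the lower
sheet).  For the computation of the homology shadow (Milnor 1968, Thm. 9.1) through the
Mayer–Vietoris cover `{Re x^{2g+1} > −3/8} ∪ {Re x^{2g+1} < −1/4}` of the base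
(`LefschetzBaseCover.lean`) the chord is inconvenient (`Re x^{2g+1}` along it is a Chebyshev-like
polynomial); along the unit-circle ARC from `ζ_i` to `ζ_{i+1}` instead, `x^{2g+1} = −e^{2πis}`, so
`Re x^{2g+1} = −cos 2πs` (`re_arcX_pow`) and the crossings with the cover are explicit.  This file
defines the arc lifts and proves that they are homotopic to the chord lifts REL END POINTS inside
the base (straight-line homotopy in `x` between arc and chord, lifted by the principal square root,
which is continuous because `‖x‖ ≤ 1` forces `Re (x^{2g+1} + 1) ≥ 0`), hence that the Hurewicz
classes agree:

* `arcX g i s = ζ_i e^{2πis/(2g+1)}` (`arcX_zero`, `arcX_one`, `norm_arcX`, `arcX_pow`, `re_arcX_pow`);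
* `arcPath g i ε hε : Path (chordEnd g i) (chordEnd g (i+1))` on the sheet `ε = ±1`, and
  `arcLoop g i` (upper arc out, lower arc back);
* **`arcPath_homotopic_chordPath`**, **`loopClass_chainLoop_eq_arcLoop`**:
  `h(chainLoop g i) = h(arcLoop g i)` in `H₁(Base g; M)`;
* the crossing data of the arc lifts with the Milnor cover, in the closed forms of
  `idxU_apply` / `idxV_apply` / `idxW_apply` (`LefschetzBaseCover*.lean`): `re_xpow_arcPath`
  (`Re x^{2g+1} = −cos 2πs`), `sheetSign_arcPath` (the sheet sign `y/√(y²)` is `ε` off the end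
  points), `sectorRoot_arcPath_of_lt_half` / `sectorRoot_arcPath_of_half_lt` (the sector root
  `x/(ν (−x^{2g+1})^{1/(2g+1)})` is `μ^i` on the first half and `μ^{i+1}` on the second half,
  `ν = e^{iπ/(2g+1)}`, `μ = e^{2πi/(2g+1)}`, `ζ_k = ν μ^k`).

Everything here is PROVED; nothing is asserted.

## References
* J. Milnor, *Singular points of complex hypersurfaces*, Ann. of Math. Studies 61 (1968), §9. [Milnor1968]
* A. Hatcher, *Algebraic Topology*, CUP 2002, Thm. 2A.1 (homotopy invariance of `h`). [HatcherAT2002]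
-/

noncomputable section

open scoped Manifold ContDiff Topology Real
open Set Function Metric

namespace Literature.Topology.FourManifolds

/-- Local notation: `𝔼 n` is the model Euclidean space `EuclideanSpace ℝ (Fin n)`. -/
local notation "𝔼 " n:arg => EuclideanSpace ℝ (Fin n)

namespace LefschetzBase

variable {g : ℕ}

/-! ### The arcs of the unit circle between consecutive branch points -/

/-- The `x`-coordinate `ζ_i e^{2πis/(2g+1)}` of the `i`-th arc (from `ζ_i` to `ζ_{i+1}` on the unit
circle). [folklore] -/
def arcX (g i : ℕ) (s : ℝ) : ℂ := branchPt g i * Complex.exp (((2 * π * s / (2 * g + 1) : ℝ)) * Complex.I)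

/-- The arc is a continuous function of its parameter. [folklore] -/
theorem continuous_arcX (g i : ℕ) : Continuous (arcX g i) := by
  unfold arcX; fun_prop

/-- Consecutive branch points differ by the rotation `e^{2πi/(2g+1)}`. [folklore] -/
theorem branchPt_succ (g i : ℕ) :
    branchPt g (i + 1) = branchPt g i * Complex.exp (((2 * π / (2 * g + 1) : ℝ)) * Complex.I) := by
  rw [branchPt, branchPt, ← Complex.exp_add]
  congr 1
  unfold branchAngle
  push_cast
  ring

/-- The arc starts at `ζ_i` … [folklore] -/
@[simp] theorem arcX_zero (g i : ℕ) : arcX g i 0 = branchPt g i := by simp [arcX]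

/-- … and ends at `ζ_{i+1}`. [folklore] -/
@[simp] theorem arcX_one (g i : ℕ) : arcX g i 1 = branchPt g (i + 1) := by
  rw [arcX, branchPt_succ, mul_one]

/-- The arc lies on the unit circle. [folklore] -/
@[simp] theorem norm_arcX (g i : ℕ) (s : ℝ) : ‖arcX g i s‖ = 1 := by
  rw [arcX, norm_mul, norm_branchPt, Complex.norm_exp_ofReal_mul_I, mul_one]

/-- **Along the arc `x^{2g+1} = −e^{2πis}`.** [folklore] -/
theorem arcX_pow (g i : ℕ) (s : ℝ) : arcX g i s ^ (2 * g + 1) = -Complex.exp (((2 * π * s : ℝ)) * Complex.I) := by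
  rw [arcX, mul_pow, branchPt_pow, ← Complex.exp_nat_mul, neg_mul, one_mul]
  congr 2
  have h : (2 * (g : ℂ) + 1) ≠ 0 := by norm_cast
  push_cast
  field_simp

/-- **Along the arc `Re x^{2g+1} = −cos 2πs`** — so the arc meets the Milnor cover
`{Re x^{2g+1} > −3/8} ∪ {Re x^{2g+1} < −1/4}` in the explicit parameter intervals `cos 2πs < 3/8`,
`cos 2πs > 1/4`. [folklore] -/
theorem re_arcX_pow (g i : ℕ) (s : ℝ) : (arcX g i s ^ (2 * g + 1)).re = -Real.cos (2 * π * s) := by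
  rw [arcX_pow, Complex.neg_re, Complex.exp_ofReal_mul_I_re]

/-! ### The arc lifts and their homotopy to the chord lifts -/

/-- A point `(x, ε √(x^{2g+1} + 1))` with `‖x‖ ≤ 1`, `ε² = 1` lies in the base (indeed in `{rho = 0}`).
[folklore] -/
theorem mk_csqrt_mem {x ε : ℂ} (hx : ‖x‖ ≤ 1) (hε : ε ^ 2 = 1) :
    mk x (ε * csqrt (x ^ (2 * g + 1) + 1)) ∈ rho g ⁻¹' Iic (1 / 4 : ℝ) := by
  have hw : w g (mk x (ε * csqrt (x ^ (2 * g + 1) + 1))) = 0 := by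
    simp only [w, Phi, cx_mk, cy_mk]
    rw [mul_pow, hε, csqrt_sq]; ring
  rw [mem_preimage, mem_Iic, rho_eq_zero_of_w_eq_zero g hw (by rw [cx_mk]; nlinarith [norm_nonneg x])]
  norm_num

/-- The lift `(x, ε √(x^{2g+1} + 1))` is continuous on any parameter space along which `‖x‖ ≤ 1`
(the radicand stays in the closed right half-plane, where the principal root is continuous).
[folklore] -/
theorem continuous_lift {T : Type*} [TopologicalSpace T] {x : T → ℂ} (hx : Continuous x)
    (h1 : ∀ t, ‖x t‖ ≤ 1) (ε : ℂ) : Continuous fun t => mk (x t) (ε * csqrt (x t ^ (2 * g + 1) + 1)) := by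
  have hrad : Continuous fun t => x t ^ (2 * g + 1) + 1 := (hx.pow _).add continuous_const
  have hsq : Continuous fun t => csqrt (x t ^ (2 * g + 1) + 1) :=
    continuous_iff_continuousAt.2 fun t =>
      ContinuousAt.comp (f := fun t => x t ^ (2 * g + 1) + 1) (g := csqrt)
        (continuousAt_csqrt (re_pow_add_one_nonneg g (h1 t))) hrad.continuousAt
  exact continuous_mk.comp (hx.prodMk (continuous_const.mul hsq))

/-- **The lift of the `i`-th arc** to the central page on the sheet `ε` (`ε = ±1`), as a path in the
base from `(ζ_i, 0)` to `(ζ_{i+1}, 0)`. [cite: Milnor1968, §9] -/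
def arcPath (g i : ℕ) (ε : ℂ) (hε : ε ^ 2 = 1) : Path (chordEnd g i) (chordEnd g (i + 1)) where
  toFun s := ⟨mk (arcX g i s) (ε * csqrt (arcX g i s ^ (2 * g + 1) + 1)), mk_csqrt_mem (by rw [norm_arcX]) hε⟩
  continuous_toFun := (continuous_lift (x := fun s : unitInterval => arcX g i s)
    ((continuous_arcX g i).comp continuous_subtype_val) (fun s => by rw [norm_arcX]) ε).subtype_mk _
  source' := by
    apply Subtype.ext
    show mk (arcX g i 0) _ = mk (branchPt g i) 0
    simp [branchPt_pow]
  target' := by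
    apply Subtype.ext
    show mk (arcX g i 1) _ = mk (branchPt g (i + 1)) 0
    simp [branchPt_pow]

/-- **The `i`-th chain loop along arcs**: out along the upper arc lift, back along the lower one.
[cite: Milnor1968, §9] -/
def arcLoop (g i : ℕ) : Path (chordEnd g i) (chordEnd g i) :=
  (arcPath g i 1 (one_pow 2)).trans (arcPath g i (-1) (by norm_num)).symm

/-- The straight-line interpolation between the arc and the chord stays in the closed unit disc.
[folklore] -/
theorem norm_interp_le (g i : ℕ) {r : ℝ} (hr : r ∈ Icc (0 : ℝ) 1) {s : ℝ} (hs : s ∈ Icc (0 : ℝ) 1) :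
    ‖((1 - r : ℝ) : ℂ) * arcX g i s + (r : ℂ) * chordX g i s‖ ≤ 1 := by
  obtain ⟨hr0, hr1⟩ := hr
  calc ‖((1 - r : ℝ) : ℂ) * arcX g i s + (r : ℂ) * chordX g i s‖
      ≤ ‖((1 - r : ℝ) : ℂ) * arcX g i s‖ + ‖(r : ℂ) * chordX g i s‖ := norm_add_le _ _
    _ ≤ (1 - r) * 1 + r * 1 := by
        rw [norm_mul, norm_mul, Complex.norm_real, Complex.norm_real, Real.norm_eq_abs, Real.norm_eq_abs,
          abs_of_nonneg (by linarith), abs_of_nonneg hr0, norm_arcX]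
        exact add_le_add le_rfl (mul_le_mul_of_nonneg_left (norm_chordX_le g i hs) hr0)
    _ = 1 := by ring

/-- **The arc lift and the chord lift are homotopic rel end points** (inside the base: the
straight-line homotopy `x_r = (1−r)·arc + r·chord` in the closed unit disc, lifted by
`y = ε √(x_r^{2g+1} + 1)`). [folklore] -/
theorem arcPath_homotopic_chordPath (g i : ℕ) (ε : ℂ) (hε : ε ^ 2 = 1) :
    (arcPath g i ε hε).Homotopic (chordPath g i ε hε) := by
  let xr : unitInterval × unitInterval → ℂ := fun z =>
    ((1 - (z.1 : ℝ) : ℝ) : ℂ) * arcX g i z.2 + ((z.1 : ℝ) : ℂ) * chordX g i z.2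
  have hxc : Continuous xr := by
    have h1 : Continuous fun z : unitInterval × unitInterval => arcX g i z.2 :=
      (continuous_arcX g i).comp (continuous_subtype_val.comp continuous_snd)
    have h2 : Continuous fun z : unitInterval × unitInterval => chordX g i z.2 :=
      (continuous_chordX g i).comp (continuous_subtype_val.comp continuous_snd)
    unfold xr; fun_prop
  have hx1 : ∀ z, ‖xr z‖ ≤ 1 := fun z => norm_interp_le g i z.1.2 z.2.2
  refine ⟨{ toFun := fun z => ⟨mk (xr z) (ε * csqrt (xr z ^ (2 * g + 1) + 1)), mk_csqrt_mem (hx1 z) hε⟩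
            continuous_toFun := (continuous_lift hxc hx1 ε).subtype_mk _
            map_zero_left := fun s => ?_
            map_one_left := fun s => ?_
            prop' := fun r s hs => ?_ }⟩
  · apply Subtype.ext
    show mk (xr (0, s)) _ = mk (arcX g i s) _
    simp [xr]
  · apply Subtype.ext
    show mk (xr (1, s)) _ = chordLift g i ε s
    simp [xr, chordLift]
  · apply Subtype.ext
    show mk (xr (r, s)) (ε * csqrt (xr (r, s) ^ (2 * g + 1) + 1)) = mk (arcX g i s) (ε * csqrt (arcX g i s ^ (2 * g + 1) + 1))
    rcases hs with hs | hs
    · rw [hs]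
      simp only [xr, Set.Icc.coe_zero, arcX_zero, chordX_zero]
      congr 1 <;> push_cast <;> ring
    · rw [mem_singleton_iff] at hs
      rw [hs]
      simp only [xr, Set.Icc.coe_one, arcX_one, chordX_one]
      congr 1 <;> push_cast <;> ring

/-! ### Crossing data of the arc lifts with the Milnor cover -/

open Literature.Topology.FourManifolds.TorusKnotMilnor

/-- `x` along the arc lift. [folklore] -/
@[simp] theorem cx_arcPath (g i : ℕ) (ε : ℂ) (hε : ε ^ 2 = 1) (s : unitInterval) :
    cx (arcPath g i ε hε s).1 = arcX g i s := cx_mk _ _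

/-- `y` along the arc lift. [folklore] -/
@[simp] theorem cy_arcPath (g i : ℕ) (ε : ℂ) (hε : ε ^ 2 = 1) (s : unitInterval) :
    cy (arcPath g i ε hε s).1 = ε * csqrt (arcX g i s ^ (2 * g + 1) + 1) := cy_mk _ _

/-- **`Re x^{2g+1} = −cos 2πs` along the arc lift**: the lift lies in `coverV g = {Re x^{2g+1} < −1/4}`
iff `cos 2πs > 1/4` and in `coverU g = {Re x^{2g+1} > −3/8}` iff `cos 2πs < 3/8`. [folklore] -/
theorem re_xpow_arcPath (g i : ℕ) (ε : ℂ) (hε : ε ^ 2 = 1) (s : unitInterval) :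
    (cx (arcPath g i ε hε s).1 ^ (2 * g + 1)).re = -Real.cos (2 * π * s) := by
  rw [cx_arcPath, re_arcX_pow]

/-- Off the end points the arc misses the branch points: `x^{2g+1} + 1 ≠ 0` for `s ∉ {0, 1}`.
[folklore] -/
theorem arcX_pow_add_one_ne_zero (g i : ℕ) {s : ℝ} (hs0 : 0 < s) (hs1 : s < 1) :
    arcX g i s ^ (2 * g + 1) + 1 ≠ 0 := by
  rw [arcX_pow, neg_add_eq_sub, sub_ne_zero, ne_comm, Ne, Complex.exp_eq_one_iff]
  rintro ⟨n, hn⟩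
  have h := congrArg Complex.im hn
  simp only [Complex.mul_im, Complex.ofReal_re, Complex.I_im, Complex.ofReal_im, Complex.I_re, mul_zero,
    add_zero, Complex.mul_re, Complex.intCast_re, Complex.re_ofNat, Complex.intCast_im, Complex.im_ofNat,
    sub_zero, Complex.ofReal_mul, zero_mul] at h
  have h' : s = n := by nlinarith [Real.pi_pos]
  have h0 : (0 : ℝ) < n := h' ▸ hs0
  have h1 : (n : ℝ) < 1 := h' ▸ hs1
  have : (0 : ℤ) < n := by exact_mod_cast h0
  have : n < (1 : ℤ) := by exact_mod_cast h1
  omega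

/-- **The sheet sign along the arc lift is `ε`** (off the end points): `y / √(y²) = ε` for
`y = ε √(x^{2g+1} + 1)`, `ε = ±1`. [folklore] -/
theorem sheetSign_arcPath (g i : ℕ) {ε : ℂ} (hε : ε ^ 2 = 1) {s : unitInterval} (hs0 : 0 < (s : ℝ)) (hs1 : (s : ℝ) < 1) :
    cy (arcPath g i ε hε s).1 / csqrt (cy (arcPath g i ε hε s).1 ^ 2) = ε := by
  have hne : csqrt (arcX g i s ^ (2 * g + 1) + 1) ≠ 0 := fun h => by
    have := csqrt_sq (arcX g i s ^ (2 * g + 1) + 1)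
    rw [h, zero_pow two_ne_zero] at this
    exact arcX_pow_add_one_ne_zero g i hs0 hs1 this.symm
  rw [cy_arcPath, mul_pow, hε, one_mul, csqrt_sq, mul_div_cancel_right₀ _ hne]

/-- `ζ_k = ν μ^k` with `ν = e^{iπ/(2g+1)}`, `μ = e^{2πi/(2g+1)}` (the notation of
`TorusKnotMilnorFibreHomology.lean` / `LefschetzBaseCoverSectors.lean`). [folklore] -/
theorem branchPt_eq_halfRoot_mul (g k : ℕ) : branchPt g k = halfRoot (2 * g + 1) * rootU (2 * g + 1) ^ k := by
  rw [branchPt, halfRoot, rootU, ← Complex.exp_nat_mul, ← Complex.exp_add]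
  congr 1
  unfold branchAngle
  have h : (2 * (g : ℂ) + 1) ≠ 0 := by norm_cast
  push_cast
  field_simp
  ring

/-- The principal `(2g+1)`-st root of `e^{iθ}` is `e^{iθ/(2g+1)}` for `θ ∈ (−π, π]`. [folklore] -/
theorem prRoot_exp (g : ℕ) {θ : ℝ} (h1 : -π < θ) (h2 : θ ≤ π) :
    prRoot (2 * g + 1) (Complex.exp ((θ : ℂ) * Complex.I)) = Complex.exp (((θ / (2 * g + 1) : ℝ) : ℂ) * Complex.I) := by
  rw [prRoot, Complex.cpow_def_of_ne_zero (Complex.exp_ne_zero _), Complex.log_exp (by simpa using h1)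
    (by simpa using h2)]
  congr 1
  have h : (2 * (g : ℂ) + 1) ≠ 0 := by norm_cast
  push_cast
  field_simp

/-- **The sector root along the first half of the arc is `μ^i`**: for `s < 1/2`,
`x / (ν (−x^{2g+1})^{1/(2g+1)}) = μ^i` (`−x^{2g+1} = e^{2πis}` has argument in `[0, π)`). [folklore] -/
theorem sectorRoot_arcPath_of_lt_half (g i : ℕ) (ε : ℂ) (hε : ε ^ 2 = 1) {s : unitInterval} (hs : (s : ℝ) < 1 / 2) :
    cx (arcPath g i ε hε s).1 / (halfRoot (2 * g + 1) * prRoot (2 * g + 1) (-(cx (arcPath g i ε hε s).1 ^ (2 * g + 1)))) =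
      rootU (2 * g + 1) ^ i := by
  rw [cx_arcPath, arcX_pow, neg_neg, prRoot_exp g (by nlinarith [Real.pi_pos, s.2.1]) (by nlinarith [Real.pi_pos]),
    arcX, branchPt_eq_halfRoot_mul]
  rw [show (2 * π * (s : ℝ) / (2 * g + 1) : ℝ) = 2 * π * s / (2 * g + 1) from rfl]
  field_simp [halfRoot_ne_zero, Complex.exp_ne_zero]

/-- **The sector root along the second half of the arc is `μ^{i+1}`**: for `s > 1/2`,
`x / (ν (−x^{2g+1})^{1/(2g+1)}) = μ^{i+1}` (`−x^{2g+1} = e^{2πi(s−1)}` has argument in `(−π, 0]`).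
[folklore] -/
theorem sectorRoot_arcPath_of_half_lt (g i : ℕ) (ε : ℂ) (hε : ε ^ 2 = 1) {s : unitInterval} (hs : 1 / 2 < (s : ℝ)) :
    cx (arcPath g i ε hε s).1 / (halfRoot (2 * g + 1) * prRoot (2 * g + 1) (-(cx (arcPath g i ε hε s).1 ^ (2 * g + 1)))) =
      rootU (2 * g + 1) ^ (i + 1) := by
  have hper : Complex.exp (((2 * π * (s : ℝ) : ℝ)) * Complex.I) = Complex.exp (((2 * π * ((s : ℝ) - 1) : ℝ)) * Complex.I) := by
    rw [show ((2 * π * ((s : ℝ) - 1) : ℝ) : ℂ) * Complex.I = ((2 * π * (s : ℝ) : ℝ)) * Complex.I + (-1 : ℤ) * (2 * π * Complex.I) by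
      push_cast; ring, Complex.exp_add, Complex.exp_int_mul_two_pi_mul_I, mul_one]
  have e1 : Complex.exp (((2 * π * (s : ℝ) / (2 * g + 1) : ℝ)) * Complex.I) =
      rootU (2 * g + 1) * Complex.exp (((2 * π * ((s : ℝ) - 1) / (2 * g + 1) : ℝ)) * Complex.I) := by
    rw [rootU, ← Complex.exp_add]; congr 1
    have h : (2 * (g : ℂ) + 1) ≠ 0 := by norm_cast
    push_cast; field_simp; ring
  rw [cx_arcPath, arcX_pow, neg_neg, hper, prRoot_exp g (by nlinarith [Real.pi_pos]) (by nlinarith [Real.pi_pos, s.2.2]),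
    arcX, branchPt_eq_halfRoot_mul, e1, pow_succ]
  field_simp [halfRoot_ne_zero, Complex.exp_ne_zero]

/-- The two chain loops (along arcs, along chords) are homotopic. [folklore] -/
theorem arcLoop_homotopic_chainLoop (g i : ℕ) : (arcLoop g i).Homotopic (chainLoop g i) :=
  (arcPath_homotopic_chordPath g i 1 _).hcomp (arcPath_homotopic_chordPath g i (-1) _).symm₂

open Literature.AlgebraicTopology.SingularHomology in
/-- **The Hurewicz class of the `i`-th chain loop is that of the arc loop**:
`h(chainLoop g i) = h(arcLoop g i)` in `H₁(Base g; M)` (Hatcher 2002, Thm. 2A.1: `h` is homotopy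
invariant). [cite: HatcherAT2002, Thm. 2A.1] -/
theorem loopClass_chainLoop_eq_arcLoop (R : Type) [CommRing R] (M : Type) [AddCommGroup M] [Module R M]
    (m : M) (g i : ℕ) : loopClass R M m (chainLoop g i) = loopClass R M m (arcLoop g i) :=
  (loopClass_eq_of_homotopic R M m (arcLoop_homotopic_chainLoop g i)).symm

end LefschetzBase

end Literature.Topology.FourManifolds
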